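import Mathlib
import Literature.AlgebraicGeometry.Morphisms.CechModuleBiproduct
import Literature.AlgebraicGeometry.Modules.SheafHomFunctor
import Literature.AlgebraicGeometry.Modules.LocalFrames
import HarnessLib

/-!
# Crux `NoZenoR` (stmt-ResolutionOfSingularities-19943), line `sandwich-cluster`, G-layer:
# `Ȟ¹` of `𝓗om(E, –)` on finite biproducts and on `𝒪_X^I` (assembly item A6 of G2)

OURS (cell res-hironaka, chain W4.4; KERNEL-L0 §16 R6 row G2, holder res-D-pv-045 AS res-L0-w44-stub-8;
plan `D/res-D-pv-045/SketchG2Assembly.lean` A6 «`δ` onto from `Ȟ¹(M~^∨) = 0`»). The companion of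
`Modules/SheafHomLeft.subsingleton_cechMH1_sheafHom_biprod` (biproducts in the FIRST variable) and of
`Morphisms/CechModuleBiproduct.subsingleton_cechMH1_biproduct`, now in the SECOND variable of `𝓗om`:

* `sheafHomMap_zero`, `sheafHomMap_sum` — `𝓗om(E, –)` is additive on morphisms (finite sums);
* **`subsingleton_cechMH1_sheafHom_biproduct`** — `Ȟ¹(𝒰, 𝓗om(E, ⨁ⱼ Nⱼ)) = 0` if all
  `Ȟ¹(𝒰, 𝓗om(E, Nⱼ)) = 0` (`J` finite; the identity `∑ⱼ 𝓗om(E, πⱼ ≫ ιⱼ) = 𝟙`);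
* **`subsingleton_cechMH1_sheafHom_free`** — `Ȟ¹(𝒰, 𝓗om(E, 𝒪_X^I)) = 0` (`I` finite) as soon as
  `Ȟ¹(𝒰, E^∨) = 0`, `E^∨ = 𝓗om(E, 𝒪_X)` (`Modules/LocalFrames.dual`): this is how G2 (vii)
  «`Ȟ¹(M~^∨) = 0`» makes the connecting map `Ȟ⁰(𝓔nd M~) → Ȟ¹(𝓗om(M~, 𝒦))` of the presentation
  `0 → 𝒦 → 𝒪_X^N → M~ → 0` surjective (tree `exists_cechDelta_eq`).

Everything is proved; no named facts. Nothing of [claim: Hironaka2017] is used. [this work]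
-/

-- single-problem summit: the doubled namespace component `ResolutionOfSingularities` is forced
set_option linter.dupNamespace false

noncomputable section

universe u v

open CategoryTheory CategoryTheory.Limits AlgebraicGeometry TopologicalSpace Opposite
open Literature.AlgebraicGeometry.Morphisms Literature.AlgebraicGeometry.Modules

namespace Summit.ResolutionOfSingularities.ResolutionOfSingularities.Theorems.NoZeno.SandwichCluster.FullSheaf

variable {A : Type u} [CommRing A] {X : Scheme.{u}} (f : X ⟶ Spec (.of A)) {ι : Type v}
  (U : ι → X.Opens) (E : X.Modules)

/-- `𝓗om(E, 0) = 0` on morphisms. [folklore] -/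
theorem sheafHomMap_zero {M N : X.Modules} : sheafHomMap E (0 : M ⟶ N) = 0 := by
  have h := sheafHomMap_add E (0 : M ⟶ N) 0
  rw [add_zero] at h
  exact left_eq_add.mp h

/-- `𝓗om(E, –)` commutes with finite sums of morphisms. [folklore] -/
theorem sheafHomMap_sum {M N : X.Modules} {J : Type*} (s : Finset J) (φ : J → (M ⟶ N)) :
    sheafHomMap E (∑ j ∈ s, φ j) = ∑ j ∈ s, sheafHomMap E (φ j) := by
  classical
  induction s using Finset.induction_on with
  | empty => rw [Finset.sum_empty, Finset.sum_empty, sheafHomMap_zero]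
  | insert j s hj ih => rw [Finset.sum_insert hj, Finset.sum_insert hj, sheafHomMap_add, ih]

/-- **`Ȟ¹(𝒰, 𝓗om(E, ⨁ⱼ Nⱼ)) = 0` if every `Ȟ¹(𝒰, 𝓗om(E, Nⱼ)) = 0`** (`J` finite): every class `x`
equals `∑ⱼ Ȟ¹(𝓗om(E, ιⱼ))(Ȟ¹(𝓗om(E, πⱼ)) x)` by `∑ⱼ πⱼ ιⱼ = 𝟙` and functoriality of `𝓗om(E, –)`, and
the inner classes vanish. [folklore] -/
theorem subsingleton_cechMH1_sheafHom_biproduct {J : Type*} [Finite J] (N : J → X.Modules)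
    [HasBiproduct N] (hN : ∀ j, Subsingleton (CechMH1 f (sheafHom E (N j)) U)) :
    Subsingleton (CechMH1 f (sheafHom E (⨁ N)) U) := by
  classical
  cases nonempty_fintype J
  refine subsingleton_of_forall_eq 0 fun x => ?_
  have hzero : ∀ j, cechMapH1 f (sheafHomMap E (biproduct.π N j)) U x = 0 := fun j =>
    Subsingleton.elim _ _
  have htot : ∑ j, biproduct.π N j ≫ biproduct.ι N j = 𝟙 (⨁ N) :=
    Limits.IsBilimit.total (biproduct.isBilimit N)
  have key : sheafHomMap E (∑ j, biproduct.π N j ≫ biproduct.ι N j) = 𝟙 (sheafHom E (⨁ N)) := by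
    rw [htot, sheafHomMap_id]
  rw [← cechMapH1_id_apply f U x, ← key, sheafHomMap_sum, cechMapH1_sum_apply]
  refine Finset.sum_eq_zero fun j _ => ?_
  rw [sheafHomMap_comp, cechMapH1_comp, hzero j, map_zero]

/-- **`Ȟ¹(𝒰, 𝓗om(E, 𝒪_X^I)) = 0` (`I` finite) if `Ȟ¹(𝒰, E^∨) = 0`** (`𝒪_X^I = free I ≅ ⨁_I 𝒪_X`,
`E^∨ = 𝓗om(E, 𝒪_X)`). [folklore] -/
theorem subsingleton_cechMH1_sheafHom_free (I : Type u) [Finite I]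
    (hdual : Subsingleton (CechMH1 f (dual E) U)) :
    Subsingleton (CechMH1 f (sheafHom E (SheafOfModules.free (R := X.ringCatSheaf) I)) U) := by
  haveI : HasFiniteBiproducts X.Modules := HasFiniteBiproducts.of_hasFiniteProducts
  have hsum : Subsingleton (CechMH1 f (sheafHom E (⨁ fun _ : I => (unitModule X : X.Modules))) U) :=
    subsingleton_cechMH1_sheafHom_biproduct f U E _ fun _ => hdual
  -- `free I = ∐_I 𝒪_X ≅ ⨁_I 𝒪_X`, transported through the functor `𝓗om(E, –)`
  exact subsingleton_cechMH1_of_iso f U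
    ((sheafHomFunctor E).mapIso (biproduct.isoCoproduct fun _ : I => (unitModule X : X.Modules))).symm hsum

end Summit.ResolutionOfSingularities.ResolutionOfSingularities.Theorems.NoZeno.SandwichCluster.FullSheaf

end
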